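import Summits.QuantumFields.YangMills.Theorems.FluctuationComparisonRegPrIntLS2BetaCritPairOfMultiplier
import HarnessLib

/-!
# S2β ∕ GAP♯∘ strata residue, the (RINV-curl) DOOR — PREIMAGES WITH SMALL COVARIANT CURL FROM FACE SPREADS WITH A CONTRACTING DEFECT
# (the linear algebra of the face-preimage road; DEFINITION-FREE)

Cell `ym3-torus` (YM ladder rung R3 = continuum `SU(2)` Yang–Mills on the three-torus — a RUNG: NOT d = 4, NOT infinite volume,
NOT a mass gap, NOT Clay).  Width seat «width 16» `ym3-torus-px16` (gen 21), FREE px helper on crux `stmt-QuantumFields-20520`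
(`FluctuationComparisonRegPrIntL`), count-neutral, DEFINITION-FREE (0 `def`, 0 `instance`, 0 `notation`, 0 `sorry`), default heartbeats.

WHAT.  The second conjunct of (PRE) in ✓`…S2BetaMultOfPreimages.multAx_of_preimages` — (RINV-curl): «every coarse tangent `v` has a `DM`-preimage `ζ` with
`Σ_p‖(curl_{U₀}ζ)_p‖ ≤ C_R·N·‖v‖₁`» — from FACE DATA at the background `U₀`: for every coarse bond `B` a LINEAR face spread `X_B : ℝ³ → (bonds → ℝ³)` and defect
`u_B : ℝ³ → ℝ³` with
  (i) `DM (X_B w) = e_B ⊗ (w − u_B w)`  — the face-preimage identity (✓∕⧗`…S2BetaFacePreimageIdentity`: (B1′)+(B2), `u_B w = DM(I_w)(B)`),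
  (ii) `‖u_B w‖ ≤ ½‖w‖`  — (D2) «`‖(DM Y)(B)‖ ≤ A·N·‖Y‖_∞`» (px13 g25) × the thin-loop smallness `‖I_w‖_∞ ≤ 4C₁θ_J N⁻¹‖w‖` of the comb transporter,
  (iii) `Σ_p ‖(curl_{U₀} X_B w)_p‖ ≤ C‖w‖`  — the face curl count (`C = (4 + 6C₁θ_J)·N`).
* §1 ★★`exists_preimage_of_faceSpreads` (ABSTRACT: any finite-dimensional `E`, any linear `DM`, any subadditive absolutely homogeneous `Φ`): (i)(ii)(iii) ⇒
  `∀ v, ∃ ζ, DM ζ = v ∧ Φ ζ ≤ 2C·Σ_B‖v B‖` (`1 − u_B` is injective hence onto with `‖(1 − u_B)⁻¹‖ ≤ 2`, `exists_sub_apply_eq_of_norm_le_half`; `ζ := Σ_B X_B w_B`).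
* §2 `curlCount_add_le`, `curlCount_smul` (the covariant curl count of ✓`…S2BetaCritPairOfMultiplier.abs_firstVariation_le_curl` is a seminorm: `adSU2 g` is linear) and
  ★★★`exists_preimage_curl_of_faceSpreads` — the CONCRETE door at any `P : Params`, level `j`, background `U₀ : GaugeField P j SU(2)`, coarse index type `κ`:
  (i)(ii)(iii) ⇒ **`∀ v : κ → ℝ³, ∃ ζ, DM ζ = v ∧ Σ_p‖(curl_{U₀}ζ)_p‖ ≤ 2C·Σ_B‖v B‖`** — the (PRE) conjunct at `U₀` with `C_R·L^{K−J} := 2C` once the assembly (px5 g22)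
  instantiates `DM` with its pinned linearised constraint and `κ := PBond (F.P J) 0`.

HONEST SCOPE.  A DOOR (linear algebra over HYPOTHESIS data); (i)–(iii) are NOT proved here; nothing of Bałaban's analysis is asserted; (RINV-curl), (D2), MULT♮,
AVG₂♭-ax, «CRIT-ax», (D-ax), GAP♯∘ (`stub_uniformFibreGapOrbit`; registry `Lines/semiclassical_s2beta.lean` 3732b7df UNTOUCHED), the five registered stubs, S2β,
crux 20520, 19936, 19200 and `YM3TorusSU2` are NOT proved; no registered stub is closed; the Yang–Mills mass gap is NOT proved.  Sorry-free, axioms standard.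

References: T. Bałaban, CMP **98** (1985) 17–51 [Balaban1985Averaging] ((125) p.36; Sect. D (139)–(147) pp.39–40, the right inverse of the linearised
averaging); CMP **102** (1985) 277–309 [Balaban1985Variational] ((34) p.283).
-/

set_option autoImplicit false

noncomputable section

open Set Function
open scoped Matrix.Norms.L2Operator RealInnerProductSpace

namespace Summit.QuantumFields.YangMills.Theorems.FluctuationComparisonRegPrIntLS2BetaPreimagesOfFaceSpreads

/-! ## §1 The linear algebra: a block-diagonal image `e_B ⊗ (1 − u_B)` with `‖u_B‖ ≤ ½` inverts, and a seminorm bound sums over the bonds -/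

section Abstract

variable {ι κ E : Type*} [Fintype κ] [DecidableEq κ] [NormedAddCommGroup E] [NormedSpace ℝ E] [FiniteDimensional ℝ E]

/-- A linear map `u` with `‖u w‖ ≤ ½‖w‖` has `1 − u` bijective with `‖(1 − u)⁻¹ v‖ ≤ 2‖v‖`: every `v` is `w − u w` for a (unique) `w` with `‖w‖ ≤ 2‖v‖`
(finite dimension: injective ⇒ surjective). [folklore] -/
theorem exists_sub_apply_eq_of_norm_le_half (u : E →ₗ[ℝ] E) (hu : ∀ w, ‖u w‖ ≤ ‖w‖ / 2) (v : E) :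
    ∃ w : E, w - u w = v ∧ ‖w‖ ≤ 2 * ‖v‖ := by
  set T : E →ₗ[ℝ] E := LinearMap.id - u with hT
  have hTw : ∀ w, T w = w - u w := fun w => by rw [hT, LinearMap.sub_apply, LinearMap.id_apply]
  have hlow : ∀ w, ‖w‖ ≤ 2 * ‖T w‖ := by
    intro w
    have h1 : ‖w‖ ≤ ‖w - u w‖ + ‖u w‖ := by
      calc ‖w‖ = ‖(w - u w) + u w‖ := by rw [sub_add_cancel]
        _ ≤ ‖w - u w‖ + ‖u w‖ := norm_add_le _ _
    have h2 := hu w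
    rw [hTw]
    linarith
  have hinj : Function.Injective T := by
    intro a b hab
    have h := hlow (a - b)
    rw [map_sub, hab, sub_self, norm_zero, mul_zero] at h
    exact sub_eq_zero.1 (norm_le_zero_iff.1 h)
  have hsurj : Function.Surjective T := LinearMap.surjective_of_injective hinj
  obtain ⟨w, hw⟩ := hsurj v
  refine ⟨w, ?_, ?_⟩
  · rw [← hw, hTw]
  · rw [← hw]; exact hlow w

/-- ★★ **PREIMAGES FROM FACE SPREADS, ABSTRACT FORM.**  Let `DM : (ι → E) →ₗ (κ → E)` be linear, `Φ` a subadditive absolutely homogeneous functional on `ι → E`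
(the covariant curl count), and suppose every coarse coordinate `B : κ` carries a linear FACE SPREAD `X_B : E →ₗ (ι → E)` and a linear DEFECT `u_B : E →ₗ E` with
`DM (X_B w) = e_B ⊗ (w − u_B w)`, `‖u_B w‖ ≤ ½‖w‖`, `Φ (X_B w) ≤ C‖w‖`.  Then every `v : κ → E` has a preimage `ζ` with `DM ζ = v` and `Φ ζ ≤ 2C·Σ_B ‖v B‖`.
[cite: Balaban1985Averaging, (125) p.36, Sect. D pp.39-40 (the right inverse of the linearised averaging; here abstracted)] -/
theorem exists_preimage_of_faceSpreads (DM : (ι → E) →ₗ[ℝ] (κ → E)) (Φ : (ι → E) → ℝ) (hΦ0 : Φ 0 = 0)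
    (hΦadd : ∀ ζ ζ' : ι → E, Φ (ζ + ζ') ≤ Φ ζ + Φ ζ') (hΦsmul : ∀ (a : ℝ) (ζ : ι → E), Φ (a • ζ) = |a| * Φ ζ)
    (X : κ → E →ₗ[ℝ] (ι → E)) (u : κ → E →ₗ[ℝ] E) {C : ℝ}
    (hDM : ∀ (B : κ) (w : E), DM (X B w) = Pi.single B (w - u B w))
    (hu : ∀ (B : κ) (w : E), ‖u B w‖ ≤ ‖w‖ / 2) (hX : ∀ (B : κ) (w : E), Φ (X B w) ≤ C * ‖w‖) (v : κ → E) :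
    ∃ ζ : ι → E, DM ζ = v ∧ Φ ζ ≤ 2 * C * ∑ B, ‖v B‖ := by
  classical
  have hC : ∀ B : κ, v B ≠ 0 → 0 ≤ C := by
    intro B hB
    obtain ⟨w, hw, hwle⟩ := exists_sub_apply_eq_of_norm_le_half (u B) (hu B) (v B)
    have hw0 : w ≠ 0 := by rintro rfl; rw [map_zero, sub_zero] at hw; exact hB hw.symm
    have h1 : 0 ≤ Φ (X B w) := by
      have h2 := hΦadd (X B w) (-(X B w))
      rw [add_neg_cancel, hΦ0, show -(X B w) = (-1 : ℝ) • X B w by rw [neg_one_smul], hΦsmul] at h2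
      norm_num at h2; linarith
    exact nonneg_of_mul_nonneg_left (h1.trans (hX B w)) (norm_pos_iff.2 hw0)
  choose w hw hwle using fun B => exists_sub_apply_eq_of_norm_le_half (u B) (hu B) (v B)
  refine ⟨∑ B, X B (w B), ?_, ?_⟩
  · rw [map_sum]
    funext B'
    rw [Finset.sum_apply]
    simp_rw [hDM, hw]
    rw [Finset.sum_eq_single B' (fun B _ hB => Pi.single_eq_of_ne' hB _) (fun h => (h (Finset.mem_univ _)).elim), Pi.single_eq_same]
  · -- subadditivity over the finite sum, then the per-bond bounds
    have hsum : ∀ s : Finset κ, Φ (∑ B ∈ s, X B (w B)) ≤ ∑ B ∈ s, C * ‖w B‖ := by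
      intro s
      induction s using Finset.induction_on with
      | empty => rw [Finset.sum_empty, Finset.sum_empty, hΦ0]
      | insert B s hB ih =>
        rw [Finset.sum_insert hB, Finset.sum_insert hB]
        exact (hΦadd _ _).trans (add_le_add (hX B (w B)) ih)
    refine (hsum Finset.univ).trans ?_
    rw [Finset.mul_sum]
    refine Finset.sum_le_sum fun B _ => ?_
    by_cases hB : v B = 0
    · -- then `w B = 0` is forced: `‖w B‖ ≤ 2‖v B‖ = 0`
      have hw0 : w B = 0 := by
        have h := hwle B; rw [hB, norm_zero, mul_zero] at h; exact norm_le_zero_iff.1 h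
      rw [hw0, hB, norm_zero, mul_zero, mul_zero]
    · calc C * ‖w B‖ ≤ C * (2 * ‖v B‖) := mul_le_mul_of_nonneg_left (hwle B) (hC B hB)
        _ = 2 * C * ‖v B‖ := by ring

end Abstract

/-! ## §2 The covariant curl count `Σ_p ‖(curl_{U₀} ζ)_p‖` is a seminorm, and the concrete door -/

section Curl

open Literature.MathematicalPhysics.QuantumFieldTheory.Balaban1983to89
open Literature.MathematicalPhysics.QuantumFieldTheory.Balaban1983to89.B15Prop1ChartSU2 (adSU2)

variable {P : Params} {j : ℕ}

/-- The covariant curl count is subadditive. [cite: Balaban1985Variational, (34) p.283 (bookkeeping)] -/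
theorem curlCount_add_le (U₀ : GaugeField P j (Matrix.specialUnitaryGroup (Fin 2) ℂ)) (ζ ζ' : PBond P j → EuclideanSpace ℝ (Fin 3)) :
    ∑ p : Plaq P j, ‖adSU2 (GaugeField.plaqHol U₀ p)⁻¹ ((ζ + ζ') ⟨p.src, p.μ⟩) +
        adSU2 ((GaugeField.plaqHol U₀ p)⁻¹ * U₀ ⟨p.src, p.μ⟩) ((ζ + ζ') ⟨p.src.shift p.μ, p.ν⟩) -
        adSU2 ((GaugeField.plaqHol U₀ p)⁻¹ * U₀ ⟨p.src, p.μ⟩ * U₀ ⟨p.src.shift p.μ, p.ν⟩ * (U₀ ⟨p.src.shift p.ν, p.μ⟩)⁻¹) ((ζ + ζ') ⟨p.src.shift p.ν, p.μ⟩) -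
        (ζ + ζ') ⟨p.src, p.ν⟩‖ ≤
      ∑ p : Plaq P j, ‖adSU2 (GaugeField.plaqHol U₀ p)⁻¹ (ζ ⟨p.src, p.μ⟩) + adSU2 ((GaugeField.plaqHol U₀ p)⁻¹ * U₀ ⟨p.src, p.μ⟩) (ζ ⟨p.src.shift p.μ, p.ν⟩) -
          adSU2 ((GaugeField.plaqHol U₀ p)⁻¹ * U₀ ⟨p.src, p.μ⟩ * U₀ ⟨p.src.shift p.μ, p.ν⟩ * (U₀ ⟨p.src.shift p.ν, p.μ⟩)⁻¹) (ζ ⟨p.src.shift p.ν, p.μ⟩) -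
          ζ ⟨p.src, p.ν⟩‖ +
      ∑ p : Plaq P j, ‖adSU2 (GaugeField.plaqHol U₀ p)⁻¹ (ζ' ⟨p.src, p.μ⟩) + adSU2 ((GaugeField.plaqHol U₀ p)⁻¹ * U₀ ⟨p.src, p.μ⟩) (ζ' ⟨p.src.shift p.μ, p.ν⟩) -
          adSU2 ((GaugeField.plaqHol U₀ p)⁻¹ * U₀ ⟨p.src, p.μ⟩ * U₀ ⟨p.src.shift p.μ, p.ν⟩ * (U₀ ⟨p.src.shift p.ν, p.μ⟩)⁻¹) (ζ' ⟨p.src.shift p.ν, p.μ⟩) -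
          ζ' ⟨p.src, p.ν⟩‖ := by
  rw [← Finset.sum_add_distrib]
  refine Finset.sum_le_sum fun p _ => ?_
  refine le_of_eq_of_le ?_ (norm_add_le _ _)
  congr 1
  simp only [Pi.add_apply, map_add]
  abel

/-- The covariant curl count is absolutely homogeneous. [cite: Balaban1985Variational, (34) p.283 (bookkeeping)] -/
theorem curlCount_smul (U₀ : GaugeField P j (Matrix.specialUnitaryGroup (Fin 2) ℂ)) (a : ℝ) (ζ : PBond P j → EuclideanSpace ℝ (Fin 3)) :
    ∑ p : Plaq P j, ‖adSU2 (GaugeField.plaqHol U₀ p)⁻¹ ((a • ζ) ⟨p.src, p.μ⟩) +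
        adSU2 ((GaugeField.plaqHol U₀ p)⁻¹ * U₀ ⟨p.src, p.μ⟩) ((a • ζ) ⟨p.src.shift p.μ, p.ν⟩) -
        adSU2 ((GaugeField.plaqHol U₀ p)⁻¹ * U₀ ⟨p.src, p.μ⟩ * U₀ ⟨p.src.shift p.μ, p.ν⟩ * (U₀ ⟨p.src.shift p.ν, p.μ⟩)⁻¹) ((a • ζ) ⟨p.src.shift p.ν, p.μ⟩) -
        (a • ζ) ⟨p.src, p.ν⟩‖ =
      |a| * ∑ p : Plaq P j, ‖adSU2 (GaugeField.plaqHol U₀ p)⁻¹ (ζ ⟨p.src, p.μ⟩) + adSU2 ((GaugeField.plaqHol U₀ p)⁻¹ * U₀ ⟨p.src, p.μ⟩) (ζ ⟨p.src.shift p.μ, p.ν⟩) -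
          adSU2 ((GaugeField.plaqHol U₀ p)⁻¹ * U₀ ⟨p.src, p.μ⟩ * U₀ ⟨p.src.shift p.μ, p.ν⟩ * (U₀ ⟨p.src.shift p.ν, p.μ⟩)⁻¹) (ζ ⟨p.src.shift p.ν, p.μ⟩) -
          ζ ⟨p.src, p.ν⟩‖ := by
  rw [Finset.mul_sum]
  refine Finset.sum_congr rfl fun p _ => ?_
  rw [← Real.norm_eq_abs, ← norm_smul]
  congr 1
  simp only [Pi.smul_apply, map_smul, smul_add, smul_sub]

/-- ★★★ **THE (RINV-curl) DOOR: PREIMAGES WITH SMALL COVARIANT CURL FROM FACE SPREADS WITH A CONTRACTING DEFECT.**  At a background `U₀` (any lattice `P`, level `j`),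
for a LINEAR `DM : (bonds → ℝ³) →ₗ (κ → ℝ³)` (the linearised constraint; `κ` = the coarse bonds), if every `B : κ` carries a linear face spread `X_B` and defect `u_B` with
`DM (X_B w) = e_B ⊗ (w − u_B w)` (the face identity: (B1′)+(B2) of ✓`…S2BetaChartReadGaugeAndLocality` with `u_B w = DM(I_w)(B)`), `‖u_B w‖ ≤ ½‖w‖` ((D2) × the thin-loop bound),
and `Σ_p ‖(curl_{U₀} X_B w)_p‖ ≤ C‖w‖` (the face curl count), then EVERY `v : κ → ℝ³` has `ζ` with `DM ζ = v` and `Σ_p ‖(curl_{U₀} ζ)_p‖ ≤ 2C·Σ_B ‖v B‖` — the second conjunct of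
✓`…S2BetaMultOfPreimages.multAx_of_preimages`'s (PRE) at `U₀` with `C_R·L^{K−J} := 2C`. [cite: Balaban1985Averaging, (125) p.36, Sect. D pp.39-40; Balaban1985Variational, (34) p.283] -/
theorem exists_preimage_curl_of_faceSpreads {κ : Type*} [Fintype κ] [DecidableEq κ] (U₀ : GaugeField P j (Matrix.specialUnitaryGroup (Fin 2) ℂ))
    (DM : (PBond P j → EuclideanSpace ℝ (Fin 3)) →ₗ[ℝ] (κ → EuclideanSpace ℝ (Fin 3)))
    (X : κ → EuclideanSpace ℝ (Fin 3) →ₗ[ℝ] (PBond P j → EuclideanSpace ℝ (Fin 3))) (u : κ → EuclideanSpace ℝ (Fin 3) →ₗ[ℝ] EuclideanSpace ℝ (Fin 3)) {C : ℝ}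
    (hDM : ∀ (B : κ) (w : EuclideanSpace ℝ (Fin 3)), DM (X B w) = Pi.single B (w - u B w))
    (hu : ∀ (B : κ) (w : EuclideanSpace ℝ (Fin 3)), ‖u B w‖ ≤ ‖w‖ / 2)
    (hX : ∀ (B : κ) (w : EuclideanSpace ℝ (Fin 3)),
      ∑ p : Plaq P j, ‖adSU2 (GaugeField.plaqHol U₀ p)⁻¹ (X B w ⟨p.src, p.μ⟩) + adSU2 ((GaugeField.plaqHol U₀ p)⁻¹ * U₀ ⟨p.src, p.μ⟩) (X B w ⟨p.src.shift p.μ, p.ν⟩) -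
          adSU2 ((GaugeField.plaqHol U₀ p)⁻¹ * U₀ ⟨p.src, p.μ⟩ * U₀ ⟨p.src.shift p.μ, p.ν⟩ * (U₀ ⟨p.src.shift p.ν, p.μ⟩)⁻¹) (X B w ⟨p.src.shift p.ν, p.μ⟩) -
          X B w ⟨p.src, p.ν⟩‖ ≤ C * ‖w‖)
    (v : κ → EuclideanSpace ℝ (Fin 3)) :
    ∃ ζ : PBond P j → EuclideanSpace ℝ (Fin 3), DM ζ = v ∧
      ∑ p : Plaq P j, ‖adSU2 (GaugeField.plaqHol U₀ p)⁻¹ (ζ ⟨p.src, p.μ⟩) + adSU2 ((GaugeField.plaqHol U₀ p)⁻¹ * U₀ ⟨p.src, p.μ⟩) (ζ ⟨p.src.shift p.μ, p.ν⟩) -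
          adSU2 ((GaugeField.plaqHol U₀ p)⁻¹ * U₀ ⟨p.src, p.μ⟩ * U₀ ⟨p.src.shift p.μ, p.ν⟩ * (U₀ ⟨p.src.shift p.ν, p.μ⟩)⁻¹) (ζ ⟨p.src.shift p.ν, p.μ⟩) -
          ζ ⟨p.src, p.ν⟩‖ ≤ 2 * C * ∑ B, ‖v B‖ := by
  refine exists_preimage_of_faceSpreads DM
    (fun ζ => ∑ p : Plaq P j, ‖adSU2 (GaugeField.plaqHol U₀ p)⁻¹ (ζ ⟨p.src, p.μ⟩) + adSU2 ((GaugeField.plaqHol U₀ p)⁻¹ * U₀ ⟨p.src, p.μ⟩) (ζ ⟨p.src.shift p.μ, p.ν⟩) -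
          adSU2 ((GaugeField.plaqHol U₀ p)⁻¹ * U₀ ⟨p.src, p.μ⟩ * U₀ ⟨p.src.shift p.μ, p.ν⟩ * (U₀ ⟨p.src.shift p.ν, p.μ⟩)⁻¹) (ζ ⟨p.src.shift p.ν, p.μ⟩) -
          ζ ⟨p.src, p.ν⟩‖)
    ?_ (curlCount_add_le U₀) (curlCount_smul U₀) X u hDM hu hX v
  simp only [Pi.zero_apply, map_zero, add_zero, sub_self, norm_zero, Finset.sum_const_zero]

end Curl

end Summit.QuantumFields.YangMills.Theorems.FluctuationComparisonRegPrIntLS2BetaPreimagesOfFaceSpreads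

end
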